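import Literature.AlgebraicGeometry.Motives.GeneratingSectionsComap
import HarnessLib

/-!
# Generating sections from compatible local coefficients (a trivialised line bundle)

[cite: Hartshorne1977, Chapter II, proof of Theorem 7.1 and Exercise 5.18]
[cite: GortzWedhorn2020, Proposition 11.15 and (11.7)]

Let `X` be a scheme, `W a` (`a : α`) a family of opens of `X` and, for every index `i : ι`, a
family of regular functions `c i a ∈ Γ(X, W a)` — to be thought of as the local coefficients
`c i a = e_a⁻¹(t_i|_{W a})` of global sections `t_i` of an invertible sheaf `𝓛` trivialised by
frames `e_a : 𝒪_{W a} ≅ 𝓛|_{W a}` (so that `c i b = g_{ab} · c i a` on `W a ∩ W b` for the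
transition cocycle `g_{ab} ∈ Γ(W a ∩ W b, 𝒪_X)ˣ`, `CocycleSections.ofCocycle`). The structure
`CocycleSections ι W` records the coefficients together with the two consequences of the cocycle
relation that matter:

* `cross`: `c i b · c j a = c j b · c i a` on `W a ∩ W b` (the ratios `t_j / t_i` do not depend on
  the trivialisation);
* `locus`: `X_{c i a} ∩ W b ⊆ X_{c i b}` (the non-vanishing locus of `t_i` is intrinsic).

From these data we build (`GeneratingSections.ofCocycleSections`) the generating-sections datum
`Literature.AlgebraicGeometry.Motives.GeneratingSections` of Hartshorne II, proof of Thm. 7.1: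
the opens `U i = ⋃_a X_{c i a}` ("`X_{t_i}`") and the ratios `ratio i j ∈ Γ(X, U i)`
("`t_j / t_i`"), obtained by GLUING the local functions `c j a / c i a ∈ Γ(X, X_{c i a})` (sheaf
axiom of `𝒪_X`, Mathlib `TopCat.Sheaf.existsUnique_gluing'`); the cover condition is
`⋃_{i,a} X_{c i a} = X` ("the `t_i` generate `𝓛`"). API: the defining local formula
(`ofCocycleSections_ratio_res_mul`), the uniqueness of the ratio (`ofCocycleSections_ratio_unique`),
the coefficients of a cocycle of units (`CocycleSections.ofCocycle`) and the pulled-back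
coefficients along `h : T → X` (`CocycleSections.comap`; the comparison with
`GeneratingSections.comap` is the sequel file `GeneratingSectionsOfCocycleComap`).
Elementary sheaf-of-rings bookkeeping on `𝒪_X`; the citations locate `(𝓛, (t_i)) ↦ (X → ℙⁿ)`.
-/

open CategoryTheory Opposite TopologicalSpace AlgebraicGeometry

universe v u

noncomputable section

namespace Literature.AlgebraicGeometry.Motives

namespace GeneratingSections

variable {ι : Type} {α : Type v} {X : Scheme.{u}}

/-- **Sections of a trivialised line bundle, in coefficients**: regular functions
`coeff i a ∈ Γ(X, W a)` (the coefficient of the section `t_i` in the `a`-th trivialisation) which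
are CROSS-COMPATIBLE (`c i b · c j a = c j b · c i a` on `W a ∩ W b`) and LOCUS-COMPATIBLE
(`X_{c i a} ∩ W b ⊆ X_{c i b}`) — the two consequences of `c i b = g_{ab} · c i a` for a cocycle of
units `g` (Hartshorne II, proof of Thm. 7.1). [cite: Hartshorne1977, II proof of Thm. 7.1] -/
structure CocycleSections (ι : Type) (W : α → X.Opens) where
  /-- The coefficient of the `i`-th section in the `a`-th trivialisation. -/
  coeff : ι → (a : α) → Γ(X, W a)
  /-- Cross-multiplication compatibility `c i b · c j a = c j b · c i a` on `W a ∩ W b`. -/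
  cross : ∀ i j a b,
    X.presheaf.map (homOfLE (inf_le_right : W a ⊓ W b ≤ W b)).op (coeff i b) *
        X.presheaf.map (homOfLE (inf_le_left : W a ⊓ W b ≤ W a)).op (coeff j a) =
      X.presheaf.map (homOfLE (inf_le_right : W a ⊓ W b ≤ W b)).op (coeff j b) *
        X.presheaf.map (homOfLE (inf_le_left : W a ⊓ W b ≤ W a)).op (coeff i a)
  /-- Locus compatibility `X_{c i a} ∩ W b ⊆ X_{c i b}`. -/
  locus : ∀ i a b, X.basicOpen (coeff i a) ⊓ W b ≤ X.basicOpen (coeff i b)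

variable (W : α → X.Opens) (S : CocycleSections ι W)

namespace OfCocycleSections

/-! ### Restriction bookkeeping on `𝒪_X` -/

omit S in
/-- Restricting twice is restricting once. [folklore] -/
private theorem res_res {U V V' : X.Opens} (h₁ : V ≤ U) (h₂ : V' ≤ V) (s : Γ(X, U)) :
    X.presheaf.map (homOfLE h₂).op (X.presheaf.map (homOfLE h₁).op s) =
      X.presheaf.map (homOfLE (h₂.trans h₁)).op s := by
  rw [← CommRingCat.comp_apply, ← Functor.map_comp]
  rfl

/-- The restriction of `c i a` to its non-vanishing locus `X_{c i a}` is a unit. [folklore] -/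
private theorem isUnit_res_basicOpen (i : ι) (a : α) :
    IsUnit (X.presheaf.map (homOfLE (X.basicOpen_le (S.coeff i a))).op (S.coeff i a)) :=
  RingedSpace.isUnit_res_basicOpen _ (S.coeff i a)

/-- The inverse `1 / c i a ∈ Γ(X, X_{c i a})` (non-Prop plumbing). [folklore] -/
def cinv (i : ι) (a : α) : Γ(X, X.basicOpen (S.coeff i a)) :=
  ((isUnit_res_basicOpen W S i a).unit⁻¹ : Γ(X, X.basicOpen (S.coeff i a))ˣ)

/-- `c i a · (1 / c i a) = 1` on `X_{c i a}`. [folklore] -/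
private theorem res_mul_cinv (i : ι) (a : α) :
    X.presheaf.map (homOfLE (X.basicOpen_le (S.coeff i a))).op (S.coeff i a) * cinv W S i a = 1 :=
  (isUnit_res_basicOpen W S i a).mul_val_inv

/-- `c i a · (1 / c i a) = 1` after restriction to any `V ⊆ X_{c i a}`. [folklore] -/
private theorem res_mul_res_cinv {V : X.Opens} (i : ι) (a : α) (hV : V ≤ X.basicOpen (S.coeff i a)) :
    X.presheaf.map (homOfLE (hV.trans (X.basicOpen_le (S.coeff i a)))).op (S.coeff i a) *
        X.presheaf.map (homOfLE hV).op (cinv W S i a) = 1 := by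
  rw [← res_res (X.basicOpen_le (S.coeff i a)) hV, ← map_mul, res_mul_cinv, map_one]

/-- `1 / c i a` is a unit, so its non-vanishing locus is all of `X_{c i a}`. [folklore] -/
private theorem basicOpen_cinv (i : ι) (a : α) :
    X.basicOpen (cinv W S i a) = X.basicOpen (S.coeff i a) :=
  X.basicOpen_of_isUnit (Units.isUnit _)

/-! ### The local ratios `c j a / c i a` and their gluing -/

/-- The local ratio `c j a / c i a ∈ Γ(X, X_{c i a})` (non-Prop plumbing). [folklore] -/
def locRatio (i j : ι) (a : α) : Γ(X, X.basicOpen (S.coeff i a)) :=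
  X.presheaf.map (homOfLE (X.basicOpen_le (S.coeff i a))).op (S.coeff j a) * cinv W S i a

/-- `c i a / c i a = 1`. [folklore] -/
private theorem locRatio_self (i : ι) (a : α) : locRatio W S i i a = 1 :=
  res_mul_cinv W S i a

/-- The non-vanishing locus of `c j a / c i a` is `X_{c i a} ∩ X_{c j a}`. [folklore] -/
private theorem basicOpen_locRatio (i j : ι) (a : α) :
    X.basicOpen (locRatio W S i j a) = X.basicOpen (S.coeff i a) ⊓ X.basicOpen (S.coeff j a) := by
  rw [locRatio, Scheme.basicOpen_mul, Scheme.basicOpen_res, basicOpen_cinv, inf_assoc,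
    inf_comm (X.basicOpen (S.coeff j a)), ← inf_assoc, inf_idem]

omit W S in
/-- Ring identity behind the compatibility of the local ratios. [folklore] -/
private theorem ratio_eq_ratio_of_cross {R : Type*} [CommRing R] {A B ua ub ua' ub' : R}
    (ha : ua * ua' = 1) (hb : ub * ub' = 1) (h : ub * A = B * ua) : A * ua' = B * ub' := by
  linear_combination ua' * ub' * h - A * ua' * hb + B * ub' * ha

/-- The local ratios `c j a / c i a` agree on the overlaps `X_{c i a} ∩ X_{c i b}`. [folklore] -/
private theorem locRatio_compatible (i j : ι) :
    TopCat.Presheaf.IsCompatible X.presheaf (fun a => X.basicOpen (S.coeff i a))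
      fun a => locRatio W S i j a := by
  intro a b
  have hVa : X.basicOpen (S.coeff i a) ⊓ X.basicOpen (S.coeff i b) ≤ X.basicOpen (S.coeff i a) :=
    inf_le_left
  have hVb : X.basicOpen (S.coeff i a) ⊓ X.basicOpen (S.coeff i b) ≤ X.basicOpen (S.coeff i b) :=
    inf_le_right
  have hVW : X.basicOpen (S.coeff i a) ⊓ X.basicOpen (S.coeff i b) ≤ W a ⊓ W b :=
    inf_le_inf (X.basicOpen_le _) (X.basicOpen_le _)
  have hcV := congr_arg (X.presheaf.map (homOfLE hVW).op) (S.cross i j a b)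
  simp only [map_mul, res_res] at hcV
  change X.presheaf.map (homOfLE hVa).op (locRatio W S i j a) =
    X.presheaf.map (homOfLE hVb).op (locRatio W S i j b)
  simp only [locRatio, map_mul, res_res]
  exact ratio_eq_ratio_of_cross (res_mul_res_cinv W S i a hVa) (res_mul_res_cinv W S i b hVb) hcV

/-- The local ratios glue uniquely to a function on `⋃_a X_{c i a}`. [folklore] -/
private theorem existsUnique_glueRatio (i j : ι) :
    ∃! r : Γ(X, ⨆ a, X.basicOpen (S.coeff i a)),
      ∀ a, X.presheaf.map (homOfLE (le_iSup (fun a => X.basicOpen (S.coeff i a)) a)).op r =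
        locRatio W S i j a :=
  TopCat.Sheaf.existsUnique_gluing' X.sheaf (fun a => X.basicOpen (S.coeff i a))
    (⨆ a, X.basicOpen (S.coeff i a))
    (fun a => homOfLE (le_iSup (fun a => X.basicOpen (S.coeff i a)) a))
    le_rfl (fun a => locRatio W S i j a) (locRatio_compatible W S i j)

/-- The glued ratio `t_j / t_i ∈ Γ(X, ⋃_a X_{c i a})`: the unique function restricting to
`c j a / c i a` on every `X_{c i a}` (non-Prop plumbing: the `ratio` of `ofCocycleSections`). [folklore] -/
def glueRatio (i j : ι) : Γ(X, ⨆ a, X.basicOpen (S.coeff i a)) :=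
  (existsUnique_glueRatio W S i j).exists.choose

/-- Defining local formula: `glueRatio i j |_{X_{c i a}} = c j a / c i a`. [folklore] -/
private theorem glueRatio_res (i j : ι) (a : α) :
    X.presheaf.map (homOfLE (le_iSup (fun a => X.basicOpen (S.coeff i a)) a)).op
        (glueRatio W S i j) = locRatio W S i j a :=
  (existsUnique_glueRatio W S i j).exists.choose_spec a

/-- Uniqueness of the gluing. [folklore] -/
private theorem glueRatio_unique (i j : ι) (r : Γ(X, ⨆ a, X.basicOpen (S.coeff i a)))
    (hr : ∀ a, X.presheaf.map (homOfLE (le_iSup (fun a => X.basicOpen (S.coeff i a)) a)).op r =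
      locRatio W S i j a) :
    r = glueRatio W S i j :=
  (existsUnique_glueRatio W S i j).unique hr (glueRatio_res W S i j)

/-- `t_i / t_i = 1`. [folklore] -/
private theorem glueRatio_self (i : ι) : glueRatio W S i i = 1 :=
  (glueRatio_unique W S i i 1 fun a => by rw [map_one, locRatio_self]).symm

/-- `X_{t_j / t_i} = ⋃_a (X_{c i a} ∩ X_{c j a})`. [folklore] -/
private theorem basicOpen_glueRatio (i j : ι) :
    X.basicOpen (glueRatio W S i j) = ⨆ a, X.basicOpen (S.coeff i a) ⊓ X.basicOpen (S.coeff j a) := by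
  have h1 : X.basicOpen (glueRatio W S i j) =
      (⨆ a, X.basicOpen (S.coeff i a)) ⊓ X.basicOpen (glueRatio W S i j) :=
    (inf_eq_right.mpr (X.basicOpen_le _)).symm
  rw [h1, iSup_inf_eq]
  refine iSup_congr fun a => ?_
  rw [← X.basicOpen_res (glueRatio W S i j)
    (homOfLE (le_iSup (fun a => X.basicOpen (S.coeff i a)) a)).op, glueRatio_res,
    basicOpen_locRatio]

/-- `(⋃_a X_{c i a}) ∩ (⋃_a X_{c j a}) = ⋃_a (X_{c i a} ∩ X_{c j a})` (uses `locus`). [folklore] -/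
private theorem iSup_inf_iSup_eq (i j : ι) :
    (⨆ a, X.basicOpen (S.coeff i a)) ⊓ (⨆ a, X.basicOpen (S.coeff j a)) =
      ⨆ a, X.basicOpen (S.coeff i a) ⊓ X.basicOpen (S.coeff j a) := by
  apply le_antisymm
  · rw [iSup_inf_eq]
    refine iSup_le fun a => ?_
    rw [inf_iSup_eq]
    refine iSup_le fun b => le_trans (le_inf inf_le_left ?_)
      (le_iSup (fun a => X.basicOpen (S.coeff i a) ⊓ X.basicOpen (S.coeff j a)) a)
    calc X.basicOpen (S.coeff i a) ⊓ X.basicOpen (S.coeff j b)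
          ≤ X.basicOpen (S.coeff j b) ⊓ W a :=
          le_inf inf_le_right (inf_le_left.trans (X.basicOpen_le _))
      _ ≤ X.basicOpen (S.coeff j a) := S.locus j b a
  · exact iSup_le fun a => inf_le_inf (le_iSup (fun a => X.basicOpen (S.coeff i a)) a)
      (le_iSup (fun a => X.basicOpen (S.coeff j a)) a)

/-- `X_{t_j / t_i} = X_{t_i} ∩ X_{t_j}`. [folklore] -/
private theorem basicOpen_glueRatio_eq (i j : ι) :
    X.basicOpen (glueRatio W S i j) =
      (⨆ a, X.basicOpen (S.coeff i a)) ⊓ ⨆ a, X.basicOpen (S.coeff j a) := by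
  rw [basicOpen_glueRatio, iSup_inf_iSup_eq W S]

/-- Restricting the glued ratio to an open inside one `X_{c i a}` gives the local ratio. [folklore] -/
private theorem glueRatio_res_of_le (i j : ι) (a : α) {V : X.Opens}
    (hV : V ≤ X.basicOpen (S.coeff i a)) (p : V ≤ ⨆ a, X.basicOpen (S.coeff i a)) :
    X.presheaf.map (homOfLE p).op (glueRatio W S i j) =
      X.presheaf.map (homOfLE (hV.trans (X.basicOpen_le (S.coeff i a)))).op (S.coeff j a) *
        X.presheaf.map (homOfLE hV).op (cinv W S i a) := by
  rw [← res_res (le_iSup (fun a => X.basicOpen (S.coeff i a)) a) hV, glueRatio_res, locRatio,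
    map_mul, res_res]

/-- Cocycle rule `(t_j/t_i) · (t_l/t_j) = t_l/t_i` on `X_{t_i} ∩ X_{t_j}`. [folklore] -/
private theorem glueRatio_mul_glueRatio (i j l : ι) :
    X.presheaf.map (homOfLE (inf_le_left :
        (⨆ a, X.basicOpen (S.coeff i a)) ⊓ (⨆ a, X.basicOpen (S.coeff j a)) ≤ _)).op
        (glueRatio W S i j) *
      X.presheaf.map (homOfLE (inf_le_right :
        (⨆ a, X.basicOpen (S.coeff i a)) ⊓ (⨆ a, X.basicOpen (S.coeff j a)) ≤ _)).op
        (glueRatio W S j l) =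
    X.presheaf.map (homOfLE (inf_le_left :
        (⨆ a, X.basicOpen (S.coeff i a)) ⊓ (⨆ a, X.basicOpen (S.coeff j a)) ≤ _)).op
        (glueRatio W S i l) := by
  refine X.sheaf.eq_of_locally_eq' (fun a => X.basicOpen (S.coeff i a) ⊓ X.basicOpen (S.coeff j a))
    ((⨆ a, X.basicOpen (S.coeff i a)) ⊓ ⨆ a, X.basicOpen (S.coeff j a))
    (fun a => homOfLE (inf_le_inf (le_iSup (fun a => X.basicOpen (S.coeff i a)) a)
      (le_iSup (fun a => X.basicOpen (S.coeff j a)) a)))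
    (by rw [iSup_inf_iSup_eq W S i j]) _ _ fun a => ?_
  have hVi : X.basicOpen (S.coeff i a) ⊓ X.basicOpen (S.coeff j a) ≤ X.basicOpen (S.coeff i a) :=
    inf_le_left
  have hVj : X.basicOpen (S.coeff i a) ⊓ X.basicOpen (S.coeff j a) ≤ X.basicOpen (S.coeff j a) :=
    inf_le_right
  change X.presheaf.map _ (_ * _) = X.presheaf.map _ _
  rw [map_mul, res_res, res_res, res_res, glueRatio_res_of_le W S i j a hVi,
    glueRatio_res_of_le W S j l a hVj, glueRatio_res_of_le W S i l a hVi]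
  have hj := res_mul_res_cinv W S j a hVj
  linear_combination
    (X.presheaf.map (homOfLE (hVi.trans (X.basicOpen_le (S.coeff i a)))).op (S.coeff l a) *
      X.presheaf.map (homOfLE hVi).op (cinv W S i a)) * hj

end OfCocycleSections

open OfCocycleSections

/-- **Generating sections of a trivialised line bundle** (Hartshorne II, proof of Thm. 7.1;
Görtz–Wedhorn Prop. 11.15): from cross- and locus-compatible local coefficients `c i a ∈ Γ(X, W a)`
of global sections `t_i` whose non-vanishing loci cover `X`, the generating-sections datum with
`U i = ⋃_a X_{c i a}` ("`X_{t_i}`") and `ratio i j = t_j / t_i` (the gluing of the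
`c j a / c i a`). [cite: Hartshorne1977, II proof of Thm. 7.1]
[cite: GortzWedhorn2020, Prop. 11.15] -/
def ofCocycleSections (hcov : ⨆ i, ⨆ a, X.basicOpen (S.coeff i a) = ⊤) : GeneratingSections ι X where
  U i := ⨆ a, X.basicOpen (S.coeff i a)
  iSup_U := hcov
  ratio i j := glueRatio W S i j
  ratio_self i := OfCocycleSections.glueRatio_self W S i
  basicOpen_ratio i j := OfCocycleSections.basicOpen_glueRatio_eq W S i j
  ratio_mul_ratio i j l := OfCocycleSections.glueRatio_mul_glueRatio W S i j l

section Api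

variable (hcov : ⨆ i, ⨆ a, X.basicOpen (S.coeff i a) = ⊤)

/-- The opens of `ofCocycleSections` are `U i = ⋃_a X_{c i a}`. [cite: Hartshorne1977, II proof of Thm. 7.1] -/
@[simp] theorem ofCocycleSections_U (i : ι) :
    (ofCocycleSections W S hcov).U i = ⨆ a, X.basicOpen (S.coeff i a) := rfl

/-- `X_{c i a} ⊆ U i = X_{t_i}`. [cite: Hartshorne1977, II proof of Thm. 7.1] -/
theorem basicOpen_le_ofCocycleSections_U (i : ι) (a : α) :
    X.basicOpen (S.coeff i a) ≤ (ofCocycleSections W S hcov).U i :=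
  le_iSup (fun a => X.basicOpen (S.coeff i a)) a

/-- **Defining local formula** (Hartshorne II, proof of Thm. 7.1: "`t_j / t_i` is the function with
`(t_j/t_i) · t_i = t_j`"): on `X_{c i a}`, `ratio i j · c i a = c j a`.
[cite: Hartshorne1977, II proof of Thm. 7.1] -/
theorem ofCocycleSections_ratio_res_mul (i j : ι) (a : α) :
    X.presheaf.map (homOfLE (basicOpen_le_ofCocycleSections_U W S hcov i a)).op
        ((ofCocycleSections W S hcov).ratio i j) *
        X.presheaf.map (homOfLE (X.basicOpen_le (S.coeff i a))).op (S.coeff i a) =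
      X.presheaf.map (homOfLE (X.basicOpen_le (S.coeff i a))).op (S.coeff j a) := by
  change X.presheaf.map (homOfLE (le_iSup (fun a => X.basicOpen (S.coeff i a)) a)).op
    (glueRatio W S i j) * _ = _
  rw [OfCocycleSections.glueRatio_res, locRatio, mul_assoc, mul_comm (cinv W S i a),
    OfCocycleSections.res_mul_cinv, mul_one]

/-- **Uniqueness of the ratio** (Hartshorne II, proof of Thm. 7.1): a function on `U i` satisfying
the defining local formula `r · c i a = c j a` on every `X_{c i a}` is `ratio i j`.
[cite: Hartshorne1977, II proof of Thm. 7.1] -/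
theorem ofCocycleSections_ratio_unique (i j : ι) (r : Γ(X, (ofCocycleSections W S hcov).U i))
    (hr : ∀ a, X.presheaf.map
        (homOfLE (basicOpen_le_ofCocycleSections_U W S hcov i a)).op r *
        X.presheaf.map (homOfLE (X.basicOpen_le (S.coeff i a))).op (S.coeff i a) =
      X.presheaf.map (homOfLE (X.basicOpen_le (S.coeff i a))).op (S.coeff j a)) :
    r = (ofCocycleSections W S hcov).ratio i j := by
  refine OfCocycleSections.glueRatio_unique W S i j r fun a => ?_
  rw [locRatio, ← hr a, mul_assoc, OfCocycleSections.res_mul_cinv, mul_one]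
  rfl

/-- `X_{t_i} ∩ X_{t_j} = ⋃_a (X_{c i a} ∩ X_{c j a})`: the common non-vanishing locus is computed
one trivialisation at a time. [cite: Hartshorne1977, II proof of Thm. 7.1] -/
theorem ofCocycleSections_U_inf_U (i j : ι) :
    (ofCocycleSections W S hcov).U i ⊓ (ofCocycleSections W S hcov).U j =
      ⨆ a, X.basicOpen (S.coeff i a) ⊓ X.basicOpen (S.coeff j a) :=
  OfCocycleSections.iSup_inf_iSup_eq W S i j

end Api

/-! ### Coefficients of sections of a line bundle given by a cocycle of units -/

namespace CocycleSections

variable {W}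

section OfCocycle

variable (c : ι → (a : α) → Γ(X, W a)) (g : (a b : α) → Γ(X, W a ⊓ W b))
  (hg : ∀ i a b, X.presheaf.map (homOfLE (inf_le_right : W a ⊓ W b ≤ W b)).op (c i b) =
    g a b * X.presheaf.map (homOfLE (inf_le_left : W a ⊓ W b ≤ W a)).op (c i a))
  (hu : ∀ a b, IsUnit (g a b))

include hg hu in
/-- If `c i b = g_{ab} · c i a` on `W a ∩ W b` for units `g_{ab}` (the `c i a` are the coefficients
of global sections of the line bundle with transition functions `g_{ab}`), then
`X_{c i a} ∩ W b ⊆ X_{c i b}`. [cite: Hartshorne1977, II proof of Thm. 7.1] -/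
theorem locus_of_cocycle (i : ι) (a b : α) : X.basicOpen (c i a) ⊓ W b ≤ X.basicOpen (c i b) := by
  have h1 : X.basicOpen (X.presheaf.map (homOfLE (inf_le_left : W a ⊓ W b ≤ W a)).op (c i a)) =
      X.basicOpen (c i a) ⊓ W b := by
    rw [Scheme.basicOpen_res]
    exact le_antisymm (le_inf inf_le_right (inf_le_left.trans inf_le_right))
      (le_inf (le_inf (inf_le_left.trans (X.basicOpen_le _)) inf_le_right) inf_le_left)
  have h2 : X.basicOpen (X.presheaf.map (homOfLE (inf_le_right : W a ⊓ W b ≤ W b)).op (c i b)) =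
      X.basicOpen (X.presheaf.map (homOfLE (inf_le_left : W a ⊓ W b ≤ W a)).op (c i a)) := by
    rw [hg i a b, Scheme.basicOpen_mul, X.basicOpen_of_isUnit (hu a b)]
    exact inf_eq_right.mpr (X.basicOpen_le _)
  rw [← h1, ← h2, Scheme.basicOpen_res]
  exact inf_le_right

/-- **Coefficients of sections of a line bundle given by a cocycle of units** form a
`CocycleSections` datum: `c i b = g_{ab} · c i a` with `g_{ab}` units implies cross- and
locus-compatibility (Hartshorne II, proof of Thm. 7.1 / Ex. 5.18 (d)).
[cite: Hartshorne1977, II proof of Thm. 7.1] -/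
def ofCocycle : CocycleSections ι W where
  coeff := c
  cross i j a b := by
    rw [hg i a b, hg j a b]
    ring
  locus := locus_of_cocycle c g hg hu

/-- The coefficients of `ofCocycle` are the given ones. [cite: Hartshorne1977, II proof of Thm. 7.1] -/
@[simp] theorem ofCocycle_coeff : (ofCocycle c g hg hu).coeff = c := rfl

end OfCocycle

/-! ### Pulled-back coefficients along `h : T → X` -/

variable {T : Scheme.{u}} (h : T ⟶ X) (S : CocycleSections ι W)

/-- Restriction after pull-back is pull-back (`appLE`) after restriction (naturality of `h^*`,
elementwise). [folklore] -/
private theorem map_app_eq {U V : X.Opens} {W' : T.Opens} (eVU : V ≤ U) (eW : W' ≤ h ⁻¹ᵁ V)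
    (eW' : W' ≤ h ⁻¹ᵁ U) (r : Γ(X, U)) :
    T.presheaf.map (homOfLE eW').op (h.app U r) =
      h.appLE V W' eW (X.presheaf.map (homOfLE eVU).op r) := by
  have h1 : h.app U ≫ T.presheaf.map (homOfLE eW').op =
      X.presheaf.map (homOfLE eVU).op ≫ h.appLE V W' eW := by
    rw [Scheme.Hom.app_eq_appLE, Scheme.Hom.appLE_map, Scheme.Hom.map_appLE]
  have h2 := ConcreteCategory.congr_hom h1 r
  rwa [CommRingCat.comp_apply, CommRingCat.comp_apply] at h2

/-- **Pulled-back coefficients**: the sections `h^* t_i` of `h^*𝓛`, trivialised on the `h⁻¹(W a)`,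
have the coefficients `h^*(c i a) ∈ Γ(T, h⁻¹(W a))`; cross- and locus-compatibility pull back
(Hartshorne II Thm. 7.1: the datum of `(h^*𝓛, h^*t_i)`). [cite: Hartshorne1977, II Thm. 7.1] -/
def comap : CocycleSections ι (fun a => h ⁻¹ᵁ W a) where
  coeff i a := h.app (W a) (S.coeff i a)
  cross i j a b := by
    have e₀ : h ⁻¹ᵁ W a ⊓ h ⁻¹ᵁ W b ≤ h ⁻¹ᵁ (W a ⊓ W b) := fun _ hx => hx
    rw [map_app_eq h (inf_le_right : W a ⊓ W b ≤ W b) e₀ inf_le_right (S.coeff i b),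
      map_app_eq h (inf_le_left : W a ⊓ W b ≤ W a) e₀ inf_le_left (S.coeff j a),
      map_app_eq h (inf_le_right : W a ⊓ W b ≤ W b) e₀ inf_le_right (S.coeff j b),
      map_app_eq h (inf_le_left : W a ⊓ W b ≤ W a) e₀ inf_le_left (S.coeff i a),
      ← map_mul, ← map_mul, S.cross]
  locus i a b := by
    rw [← Scheme.preimage_basicOpen, ← Scheme.preimage_basicOpen]
    exact fun x hx => S.locus i a b hx

/-- The pulled-back coefficients are `h^*(c i a)` (`rfl`). [cite: Hartshorne1977, II Thm. 7.1] -/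
@[simp] theorem comap_coeff (i : ι) (a : α) : (S.comap h).coeff i a = h.app (W a) (S.coeff i a) :=
  rfl

end CocycleSections

end GeneratingSections

end Literature.AlgebraicGeometry.Motives
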